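import Summits.QuantumFields.YangMills.Theorems.ParabolicTrajectoryContinuumLimitOnTrajectoryStubOSLegsA_Lattice

/-!
# Stub `stub_transl : TranslOfUUVB` (line `two-orbit-synchronisation`, crux stmt-QuantumFields-10522) — helper A: relocation of the box seam

First helper file of the stub worker for `stub_transl` (seat c2, wave 1): LATTICE KINEMATICS of
`curvDistribution r sch k p F = ∑_{x ∈ (box 4 L_k)^p} F(a_k x⃗) H_k(x⃗)`, `H_k(x⃗) = ∫ ∏ᵢ cw(xᵢ) dμ_k` (OSLegsA
`curvDistribution_eq_sum`), under LATTICE translations `a_k v`, `v ∈ ℤ⁴`. No new definitions: the box representative of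
`n mod (2L+1)` is Mathlib's `ZMod.valMinAbs`, the coefficient `H_k` is written out.
* `H_k` on all of `(ℤ⁴)^p` is bounded by `C^p` uniformly in `k` (`Transl.exists_uniform_bound_cw`,
  `Transl.abs_integral_prod_cw_le`), jointly `(2L_k+1)`-PERIODIC (`Transl.cw_congr`, the corner density is read on the
  periodic lift) and jointly TRANSLATION INVARIANT (`Transl.integral_prod_cw_add_const`, OSLegsA
  `integral_comp_configShift_torusLift`);
* `Transl.valMinAbs_*` — the representative `ρ(n) = valMinAbs (n : ZMod (2L+1)) ∈ [-L, L]`; the torus translation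
  `x ↦ ρ(x - v)` is a bijection of `box^p` (`Transl.bijective_boxTranslate`);
* `Transl.curvDistribution_translate_sub` — THE RELOCATION IDENTITY
  `curvDistribution (F(· - a_k v)) - curvDistribution F = ∑_{x ∈ box^p} [F(a_k (x⃗ - v⃗)) - F(a_k ρ(x⃗ - v⃗))] H_k(x⃗ - v⃗)`:
  a term is non-zero only if a coordinate of `x⃗ - v⃗` left the box, and then BOTH evaluation points have norm
  `≥ a_k L_k - ‖a_k v‖` (`Transl.far_of_valMinAbs_ne`);
* `translA_norm_translate_sub_le` (registered anchor) — the quantitative seam bound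
  `‖curvDistribution (F(· - a_k v)) - curvDistribution F‖ ≤ (2L_k+1)^{4p} · 2 C^p ‖F‖_{N,0} (a_k L_k - R)^{-N}` for
  `‖a_k v‖ ≤ R < a_k L_k` and every Schwartz order `N` (helper B makes it `o(1)` under `PolyVolumeGrowth`).
-/

set_option autoImplicit false

open scoped SchwartzMap
open MeasureTheory Filter Topology
open Literature.MathematicalPhysics.QuantumFieldTheory Literature.MathematicalPhysics.QuantumLattice
open Literature.MathematicalPhysics.AQFT
open Literature.Probability.LatticeModels (Site box mem_box card_box)
open Summit.QuantumFields.YangMills.Theses.ParabolicTrajectory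

noncomputable section

namespace Summit.QuantumFields.YangMills.Cruxes.ContinuumLimitOnTrajectory.TwoOrbitSynchronisation

namespace Transl

/-! ### §1 Integers: the box representative `valMinAbs (n : ZMod (2L+1))` -/

section Integers

variable {S : ℕ} [NeZero S] {L : ℕ}

/-- The representative lies in the box `[-L, L]` (`S = 2L+1`). -/
theorem valMinAbs_mem (hS : S = 2 * L + 1) (n : ℤ) :
    -(L : ℤ) ≤ ((n : ZMod S)).valMinAbs ∧ ((n : ZMod S)).valMinAbs ≤ L := by
  have h := ((n : ZMod S)).valMinAbs_mem_Ioc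
  subst hS
  simp only [Set.mem_Ioc, Nat.cast_add, Nat.cast_mul, Nat.cast_ofNat, Nat.cast_one] at h
  omega

omit [NeZero S] in
/-- The representative is congruent to `n`. -/
theorem dvd_valMinAbs_sub (n : ℤ) : (S : ℤ) ∣ ((n : ZMod S)).valMinAbs - n :=
  dvd_sub_comm.1 ((ZMod.intCast_eq_intCast_iff_dvd_sub _ _ S).1 (ZMod.coe_valMinAbs (n : ZMod S)))

/-- On the box the representative is `n` itself (`S = 2L+1`). -/
theorem valMinAbs_intCast_of_mem (hS : S = 2 * L + 1) {n : ℤ} (h1 : -(L : ℤ) ≤ n) (h2 : n ≤ L) :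
    ((n : ZMod S)).valMinAbs = n := by
  refine (ZMod.valMinAbs_spec _ n).2 ⟨rfl, ?_⟩
  subst hS
  simp only [Set.mem_Ioc, Nat.cast_add, Nat.cast_mul, Nat.cast_ofNat, Nat.cast_one]
  omega

/-- If `n` is NOT its own representative, the representative is far from `0`: `S - |n| ≤ |ρ(n)|`. -/
theorem abs_valMinAbs_ge {n : ℤ} (h : ((n : ZMod S)).valMinAbs ≠ n) : (S : ℤ) - |n| ≤ |((n : ZMod S)).valMinAbs| := by
  have hS : (0 : ℤ) < S := by exact_mod_cast Nat.pos_of_ne_zero (NeZero.ne S)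
  obtain ⟨m, hm⟩ := dvd_valMinAbs_sub (S := S) n
  have hm0 : m ≠ 0 := by rintro rfl; exact h (by linarith)
  have h1 : 1 ≤ |m| := Int.one_le_abs hm0
  have h2 : ((n : ZMod S)).valMinAbs = (S : ℤ) * m + n := by linarith
  have h3 : |(S : ℤ) * m| = (S : ℤ) * |m| := by rw [abs_mul, abs_of_pos hS]
  have h4 := abs_sub_abs_le_abs_sub ((S : ℤ) * m) (-n)
  rw [abs_neg, sub_neg_eq_add] at h4
  rw [h2]
  nlinarith

/-- **Seam geometry** (`S = 2L+1`). For a box coordinate `x ∈ [-L, L]` and a shift `w`: if `x - w` left the box (it is not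
its own representative) then `|x - w| ≥ L + 1` and `|ρ(x - w)| ≥ L + 1 - |w|`. -/
theorem far_of_valMinAbs_ne (hS : S = 2 * L + 1) {x w : ℤ} (hx1 : -(L : ℤ) ≤ x) (hx2 : x ≤ L)
    (h : (((x - w : ℤ) : ZMod S)).valMinAbs ≠ x - w) :
    (L : ℤ) + 1 ≤ |x - w| ∧ (L : ℤ) + 1 - |w| ≤ |(((x - w : ℤ) : ZMod S)).valMinAbs| := by
  have h1 : ¬(-(L : ℤ) ≤ x - w ∧ x - w ≤ L) := fun hh => h (valMinAbs_intCast_of_mem hS hh.1 hh.2)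
  have h2 : (L : ℤ) + 1 ≤ |x - w| := by rcases abs_cases (x - w) with ⟨h3, _⟩ | ⟨h3, _⟩ <;> omega
  refine ⟨h2, ?_⟩
  have h3 := abs_valMinAbs_ge h
  have h4 : |x - w| ≤ L + |w| := (abs_sub _ _).trans (by gcongr; exact abs_le.2 ⟨hx1, hx2⟩)
  have h5 : ((S : ℕ) : ℤ) = 2 * L + 1 := by subst hS; push_cast; ring
  linarith

/-- No wrap-around inside the box: two box coordinates congruent modulo `S = 2L+1` are equal. -/
theorem eq_of_mem_box_of_dvd (hS : S = 2 * L + 1) {x x' : ℤ} (hx1 : -(L : ℤ) ≤ x) (hx2 : x ≤ L)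
    (hx1' : -(L : ℤ) ≤ x') (hx2' : x' ≤ L) (h : (S : ℤ) ∣ x - x') : x = x' := by
  refine sub_eq_zero.1 (Int.eq_zero_of_abs_lt_dvd h ?_)
  have h5 : ((S : ℕ) : ℤ) = 2 * L + 1 := by subst hS; push_cast; ring
  rw [h5, abs_lt]
  constructor <;> linarith

end Integers

/-- **The torus translation of the box is a bijection**: `x⃗ ↦ ρ(x⃗ - v⃗)` (coordinatewise representatives) permutes
`(box 4 L)^p`. -/
theorem bijective_boxTranslate {S : ℕ} [NeZero S] {L : ℕ} (hS : S = 2 * L + 1) (p : ℕ) (v : Site 4)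
    (hmem : ∀ y : Site 4, (fun j => (((y j : ℤ) : ZMod S)).valMinAbs) ∈ box 4 L) :
    Function.Bijective fun (x : Fin p → ↥(box 4 L)) (i : Fin p) =>
      (⟨fun j => (((((x i : Site 4) - v) j : ℤ) : ZMod S)).valMinAbs, hmem _⟩ : ↥(box 4 L)) := by
  refine Finite.injective_iff_bijective.1 fun x x' hxx' => funext fun i => Subtype.ext (funext fun j => ?_)
  have h := congrArg (fun z : Fin p → ↥(box 4 L) => ((z i : Site 4) j)) hxx'
  simp only [Pi.sub_apply] at h
  have h1 : (((x i : Site 4) j - v j : ℤ) : ZMod S) = (((x' i : Site 4) j - v j : ℤ) : ZMod S) :=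
    ZMod.valMinAbs_inj.1 h
  have h2 : (S : ℤ) ∣ ((x' i : Site 4) j - v j) - ((x i : Site 4) j - v j) :=
    (ZMod.intCast_eq_intCast_iff_dvd_sub _ _ S).1 h1
  have hx := (mem_box.1 (x i).2) j
  have hx' := (mem_box.1 (x' i).2) j
  refine (eq_of_mem_box_of_dvd hS hx'.1 hx'.2 hx.1 hx.2 ?_).symm
  simpa [sub_sub_sub_cancel_right] using h2

/-- `siteToE` turns lattice differences into differences, scaled. -/
theorem smul_siteToE_sub (a : ℝ) (z w : Site 4) : a • siteToE (z - w) = a • siteToE z - a • siteToE w := by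
  rw [← smul_sub]
  congr 1
  ext i
  simp [siteToE_apply]

/-- Composition of lattice translations of gauge configurations on `ℤ⁴`. -/
theorem configShift_configShift {G : Type} [MeasurableSpace G] (a b : Site 4) (V : LGConfig 4 G) :
    configShift a (configShift b V) = configShift (a + b) V := by
  funext e
  simp only [configShift_apply, sub_sub]

/-! ### §2 The coefficient `H_k`: uniform bound, periodicity, translation invariance -/

section Coefficient

variable {G : Type} [Group G] [TopologicalSpace G] [IsTopologicalGroup G] [CompactSpace G]
  [MeasurableSpace G] [BorelSpace G]

/-- **A `k`-uniform bound of the centred curvature weight** (`|P| ≤ C_P` and `|⟨P⟩_k| ≤ C_P`). -/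
theorem exists_uniform_bound_cw (r : LatticeRep G) (sch : SpeciesScheme (YMSpecies G)) :
    ∃ C : ℝ, 0 ≤ C ∧ ∀ k x U, |cw r sch k x U| ≤ C := by
  obtain ⟨C, hC⟩ := r.curvature.bounded
  have hC0 : 0 ≤ C := (abs_nonneg _).trans (hC fun _ => 1)
  refine ⟨C + C, by positivity, fun k x U => ?_⟩
  have ha : ((sch.a k) ^ 4)⁻¹ * sch.a k ^ 4 = 1 := inv_mul_cancel₀ (pow_ne_zero 4 (sch.a_pos k).ne')
  have hmean : |wilsonTorusMean r.ρ (sch.β k) (sch.L k) r.curvature.F| ≤ C := by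
    haveI := isProbabilityMeasure_wilsonMeasure (d := 4) (L := 2 * sch.L k + 1) r.ρ r.continuous (sch.β k)
    unfold wilsonTorusMean
    have h := norm_integral_le_of_norm_le_const
      (μ := wilsonMeasure (d := 4) (L := 2 * sch.L k + 1) r.ρ (sch.β k))
      (f := fun U => r.curvature.F (torusLift (2 * sch.L k + 1) U)) (C := C)
      (Eventually.of_forall fun U => by rw [Real.norm_eq_abs]; exact hC _)
    rwa [probReal_univ, mul_one, Real.norm_eq_abs] at h
  unfold cw
  rw [ha, one_mul]
  exact (abs_sub _ _).trans (add_le_add (hC _) hmean)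

/-- The complex product integral of OSLegsA's `curvDistribution_eq_sum` is the real coefficient `H_k(y⃗) = ∫ ∏ᵢ cw(yᵢ)`. -/
theorem integral_prod_cw_eq (r : LatticeRep G) (sch : SpeciesScheme (YMSpecies G)) (k p : ℕ) (y : Fin p → Site 4) :
    ∫ U, ∏ i, ((cw r sch k (y i) U : ℝ) : ℂ) ∂(μW r sch k) = ((∫ U, ∏ i, cw r sch k (y i) U ∂(μW r sch k) : ℝ) : ℂ) := by
  rw [← integral_complex_ofReal]
  simp_rw [Complex.ofReal_prod]

/-- `|H_k(y⃗)| ≤ C^p` for a uniform bound `C` of the weights. -/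
theorem abs_integral_prod_cw_le (r : LatticeRep G) (sch : SpeciesScheme (YMSpecies G)) {C : ℝ}
    (hC : ∀ k x U, |cw r sch k x U| ≤ C) (k p : ℕ) (y : Fin p → Site 4) :
    |∫ U, ∏ i, cw r sch k (y i) U ∂(μW r sch k)| ≤ C ^ p := by
  have h := norm_integral_le_of_norm_le_const (μ := μW r sch k) (f := fun U => ∏ i, cw r sch k (y i) U)
    (C := C ^ p) (Eventually.of_forall fun U => by
      rw [Real.norm_eq_abs, Finset.abs_prod]
      calc ∏ i, |cw r sch k (y i) U| ≤ ∏ _i : Fin p, C :=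
            Finset.prod_le_prod (fun i _ => abs_nonneg _) fun i _ => hC _ _ _
        _ = C ^ p := by simp)
  rwa [probReal_univ, mul_one, Real.norm_eq_abs] at h

/-- **Periodicity of the weights**: the corner density is read on the `(2L_k+1)`-periodic lift, so congruent sites carry
the same weight. -/
theorem cw_congr (r : LatticeRep G) (sch : SpeciesScheme (YMSpecies G)) (k : ℕ) {x x' : Site 4}
    (h : ∀ j, ((x j : ℤ) : ZMod (sch.side k)) = ((x' j : ℤ) : ZMod (sch.side k))) (U : GaugeConfig 4 (sch.side k) G) :
    cw r sch k x U = cw r sch k x' U := by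
  have hV : configShift (-x) (torusLift (sch.side k) U) = configShift (-x') (torusLift (sch.side k) U) := by
    funext e
    simp only [configShift_apply, torusLift, Function.comp_apply, torusEdge, sub_neg_eq_add]
    congr 2
    funext j
    simp only [Literature.Probability.LatticeModels.Torus.proj_apply, Pi.add_apply, Int.cast_add, h j]
  unfold cw
  rw [hV]

/-- **Joint periodicity of `H_k`.** -/
theorem integral_prod_cw_congr (r : LatticeRep G) (sch : SpeciesScheme (YMSpecies G)) (k p : ℕ)
    {y y' : Fin p → Site 4} (h : ∀ i j, ((y i j : ℤ) : ZMod (sch.side k)) = ((y' i j : ℤ) : ZMod (sch.side k))) :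
    ∫ U, ∏ i, cw r sch k (y i) U ∂(μW r sch k) = ∫ U, ∏ i, cw r sch k (y' i) U ∂(μW r sch k) :=
  integral_congr_ae (Eventually.of_forall fun U => Finset.prod_congr rfl fun i _ => cw_congr r sch k (h i) U)

/-- **Joint translation invariance of `H_k`** (the torus Wilson state and the periodic lift are translation invariant). -/
theorem integral_prod_cw_add_const (r : LatticeRep G) (sch : SpeciesScheme (YMSpecies G)) (k p : ℕ)
    (y : Fin p → Site 4) (w : Site 4) :
    ∫ U, ∏ i, cw r sch k (y i + w) U ∂(μW r sch k) = ∫ U, ∏ i, cw r sch k (y i) U ∂(μW r sch k) := by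
  unfold cw
  set c : ℝ := ((sch.a k) ^ 4)⁻¹ * sch.a k ^ 4
  set m : ℝ := wilsonTorusMean r.ρ (sch.β k) (sch.L k) r.curvature.F
  have hO : Measurable fun V : LGConfig 4 G => ∏ i, c * (r.curvature.F (configShift (-(y i)) V) - m) :=
    Finset.measurable_prod _ fun i _ =>
      measurable_const.mul ((r.curvature.measurable.comp (configShift (-(y i))).measurable).sub measurable_const)
  have h := integral_comp_configShift_torusLift r.ρ (sch.β k) (sch.side k) (-w) hO
  have hV : ∀ (V : LGConfig 4 G) (i : Fin p),
      configShift (-(y i + w)) V = configShift (-(y i)) (configShift (-w) V) := by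
    intro V i
    rw [configShift_configShift, neg_add]
  have hfun : (fun U : GaugeConfig 4 (sch.side k) G =>
      ∏ i, c * (r.curvature.F (configShift (-(y i + w)) (torusLift (sch.side k) U)) - m)) =
      fun U => ∏ i, c * (r.curvature.F (configShift (-(y i)) (configShift (-w) (torusLift (sch.side k) U))) - m) :=
    funext fun U => Finset.prod_congr rfl fun i _ => by rw [hV]
  rw [hfun]
  exact h

/-! ### §3 The relocation identity -/

omit [TopologicalSpace G] [IsTopologicalGroup G] [CompactSpace G] [BorelSpace G] in
/-- Coordinatewise representatives are box sites (the scheme's torus: `side k = 2 L_k + 1`). -/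
theorem rep_mem_box (sch : SpeciesScheme (YMSpecies G)) (k : ℕ) (y : Site 4) :
    (fun j => (((y j : ℤ) : ZMod (sch.side k))).valMinAbs) ∈ box 4 (sch.L k) :=
  mem_box.2 fun j => valMinAbs_mem (S := sch.side k) rfl (y j)

/-- **The relocation identity.** Translating the test function by a lattice vector `a_k v` relocates the box: the
difference of canonical curvature distributions is the seam sum
`∑_{x ∈ box^p} [F(a_k (x⃗ - v⃗)) - F(a_k ρ(x⃗ - v⃗))] H_k(x⃗ - v⃗)`, `ρ` = coordinatewise representative in the box. -/
theorem curvDistribution_translate_sub (r : LatticeRep G) (sch : SpeciesScheme (YMSpecies G)) (k p : ℕ)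
    (F : 𝓢((Fin p → EuclideanSpace ℝ (Fin 4)), ℂ)) (v : Site 4) :
    curvDistribution r sch k p (translateMulti (sch.a k • siteToE v) F) - curvDistribution r sch k p F =
      ∑ x : Fin p → ↥(box 4 (sch.L k)),
        (F (fun i => sch.a k • siteToE ((↑(x i) : Site 4) - v)) -
            F (fun i => sch.a k • siteToE (fun j => (((((↑(x i) : Site 4) - v) j : ℤ) : ZMod (sch.side k))).valMinAbs))) *
          ((∫ U, ∏ i, cw r sch k ((↑(x i) : Site 4) - v) U ∂(μW r sch k) : ℝ) : ℂ) := by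
  rw [curvDistribution_eq_sum, curvDistribution_eq_sum]
  simp_rw [integral_prod_cw_eq]
  -- the translated sum
  have h1 : ∀ x : Fin p → ↥(box 4 (sch.L k)),
      translateMulti (sch.a k • siteToE v) F (fun i => sch.a k • siteToE (↑(x i) : Site 4)) *
          ((∫ U, ∏ i, cw r sch k (↑(x i) : Site 4) U ∂(μW r sch k) : ℝ) : ℂ) =
        F (fun i => sch.a k • siteToE ((↑(x i) : Site 4) - v)) *
          ((∫ U, ∏ i, cw r sch k ((↑(x i) : Site 4) - v) U ∂(μW r sch k) : ℝ) : ℂ) := by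
    intro x
    rw [translateMulti_apply, ← integral_prod_cw_add_const r sch k p (fun i => (↑(x i) : Site 4) - v) v]
    simp_rw [sub_add_cancel, smul_siteToE_sub]
  -- the untranslated sum, reindexed by the torus translation of the box
  have h2 : ∑ x : Fin p → ↥(box 4 (sch.L k)), F (fun i => sch.a k • siteToE (↑(x i) : Site 4)) *
        ((∫ U, ∏ i, cw r sch k (↑(x i) : Site 4) U ∂(μW r sch k) : ℝ) : ℂ) =
      ∑ x : Fin p → ↥(box 4 (sch.L k)),
        F (fun i => sch.a k • siteToE (fun j => (((((↑(x i) : Site 4) - v) j : ℤ) : ZMod (sch.side k))).valMinAbs)) *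
          ((∫ U, ∏ i, cw r sch k ((↑(x i) : Site 4) - v) U ∂(μW r sch k) : ℝ) : ℂ) := by
    refine (Fintype.sum_bijective _ (bijective_boxTranslate (S := sch.side k) rfl p v (rep_mem_box sch k)) _ _
      fun x => ?_).symm
    have hH : ∫ U, ∏ i, cw r sch k (fun j => (((((↑(x i) : Site 4) - v) j : ℤ) : ZMod (sch.side k))).valMinAbs) U
          ∂(μW r sch k) = ∫ U, ∏ i, cw r sch k ((↑(x i) : Site 4) - v) U ∂(μW r sch k) :=
      integral_prod_cw_congr r sch k p fun i j => ZMod.coe_valMinAbs _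
    show _ = F (fun i => sch.a k • siteToE (fun j => (((((↑(x i) : Site 4) - v) j : ℤ) : ZMod (sch.side k))).valMinAbs)) *
        ((∫ U, ∏ i, cw r sch k (fun j => (((((↑(x i) : Site 4) - v) j : ℤ) : ZMod (sch.side k))).valMinAbs) U
          ∂(μW r sch k) : ℝ) : ℂ)
    rw [hH]
  rw [h2, ← Finset.sum_sub_distrib]
  refine Finset.sum_congr rfl fun x _ => ?_
  rw [h1, sub_mul]

/-! ### §4 The quantitative seam bound -/

/-- Decay of a Schwartz function outside a ball: `‖F z‖ ≤ ‖F‖_{N,0} ℓ^{-N}` for `‖z‖ ≥ ℓ > 0`. -/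
theorem norm_apply_le_seminorm_div {p : ℕ} (F : 𝓢((Fin p → EuclideanSpace ℝ (Fin 4)), ℂ)) (N : ℕ) {ℓ : ℝ}
    (hℓ : 0 < ℓ) {z : Fin p → EuclideanSpace ℝ (Fin 4)} (hz : ℓ ≤ ‖z‖) :
    ‖F z‖ ≤ SchwartzMap.seminorm ℂ N 0 F / ℓ ^ N := by
  have h := SchwartzMap.norm_pow_mul_le_seminorm ℂ F N z
  rw [le_div_iff₀ (pow_pos hℓ N)]
  calc ‖F z‖ * ℓ ^ N ≤ ‖F z‖ * ‖z‖ ^ N := by gcongr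
    _ ≤ SchwartzMap.seminorm ℂ N 0 F := by rw [mul_comm]; exact h

/-- A coordinate of a scaled site is dominated by the norm of the `p`-tuple of scaled sites. -/
theorem mul_abs_le_norm {p : ℕ} {a : ℝ} (ha : 0 ≤ a) (y : Fin p → Site 4) (i : Fin p) (j : Fin 4) :
    a * |((y i j : ℤ) : ℝ)| ≤ ‖(fun i => a • siteToE (y i) : Fin p → EuclideanSpace ℝ (Fin 4))‖ := by
  have h1 : ‖(a • siteToE (y i) : EuclideanSpace ℝ (Fin 4))‖ ≤
      ‖(fun i => a • siteToE (y i) : Fin p → EuclideanSpace ℝ (Fin 4))‖ :=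
    norm_le_pi_norm (fun i => a • siteToE (y i) : Fin p → EuclideanSpace ℝ (Fin 4)) i
  have h2 : ‖(a • siteToE (y i) : EuclideanSpace ℝ (Fin 4)) j‖ ≤ ‖(a • siteToE (y i) : EuclideanSpace ℝ (Fin 4))‖ :=
    PiLp.norm_apply_le _ j
  have h3 : ‖(a • siteToE (y i) : EuclideanSpace ℝ (Fin 4)) j‖ = a * |((y i j : ℤ) : ℝ)| := by
    rw [PiLp.smul_apply, siteToE_apply, smul_eq_mul, norm_mul, Real.norm_of_nonneg ha, Real.norm_eq_abs]
  linarith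

/-- **The per-term seam estimate.** For `x ∈ box^p`, `‖a_k v‖ ≤ R < a_k L_k`: the term of the relocation identity at `x` is
bounded by `2 C^p ‖F‖_{N,0} (a_k L_k - R)^{-N}` (it vanishes unless a coordinate of `x⃗ - v⃗` left the box, and then both
evaluation points have norm `≥ a_k L_k - R`). -/
theorem norm_seamTerm_le (r : LatticeRep G) (sch : SpeciesScheme (YMSpecies G)) {C : ℝ} (hC0 : 0 ≤ C)
    (hC : ∀ k x U, |cw r sch k x U| ≤ C) (k p N : ℕ) (F : 𝓢((Fin p → EuclideanSpace ℝ (Fin 4)), ℂ)) (v : Site 4)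
    {R : ℝ} (hv : ‖sch.a k • siteToE v‖ ≤ R) (hR : R < sch.a k * sch.L k) (x : Fin p → ↥(box 4 (sch.L k))) :
    ‖(F (fun i => sch.a k • siteToE ((↑(x i) : Site 4) - v)) -
          F (fun i => sch.a k • siteToE (fun j => (((((↑(x i) : Site 4) - v) j : ℤ) : ZMod (sch.side k))).valMinAbs))) *
        ((∫ U, ∏ i, cw r sch k ((↑(x i) : Site 4) - v) U ∂(μW r sch k) : ℝ) : ℂ)‖ ≤
      2 * C ^ p * SchwartzMap.seminorm ℂ N 0 F / (sch.a k * sch.L k - R) ^ N := by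
  set y : Fin p → Site 4 := fun i => (↑(x i) : Site 4) - v with hy
  set ρ : Fin p → Site 4 := fun i j => (((y i j : ℤ) : ZMod (sch.side k))).valMinAbs with hρ
  set ℓ : ℝ := sch.a k * sch.L k - R with hℓ_def
  have ha : 0 < sch.a k := sch.a_pos k
  have hℓ : 0 < ℓ := by rw [hℓ_def]; linarith
  have hsem : 0 ≤ SchwartzMap.seminorm ℂ N 0 F := apply_nonneg _ _
  have hB : 0 ≤ 2 * C ^ p * SchwartzMap.seminorm ℂ N 0 F / ℓ ^ N := by positivity
  rw [norm_mul, Complex.norm_real, Real.norm_eq_abs]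
  have hH := abs_integral_prod_cw_le r sch hC k p y
  by_cases hcase : ∀ i, ρ i = y i
  · -- no coordinate left the box: the term vanishes
    have h0 : F (fun i => sch.a k • siteToE (y i)) - F (fun i => sch.a k • siteToE (ρ i)) = 0 := by
      simp_rw [hcase]; exact sub_self _
    rw [h0, norm_zero, zero_mul]
    exact hB
  · push Not at hcase
    obtain ⟨i, hi⟩ := hcase
    have hj : ∃ j, ρ i j ≠ y i j := by
      by_contra hcon
      push Not at hcon
      exact hi (funext hcon)
    obtain ⟨j, hj⟩ := hj
    have hxij := (mem_box.1 (x i).2) j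
    have hyij : y i j = (↑(x i) : Site 4) j - v j := rfl
    have hρij : ρ i j = ((((↑(x i) : Site 4) j - v j : ℤ) : ZMod (sch.side k))).valMinAbs := rfl
    rw [hρij, hyij] at hj
    obtain ⟨hfar1, hfar2⟩ := far_of_valMinAbs_ne (S := sch.side k) rfl hxij.1 hxij.2 hj
    -- `a |v j| ≤ R`
    have hvj : sch.a k * |((v j : ℤ) : ℝ)| ≤ R := by
      have h1 : ‖(sch.a k • siteToE v : EuclideanSpace ℝ (Fin 4)) j‖ ≤
          ‖(sch.a k • siteToE v : EuclideanSpace ℝ (Fin 4))‖ := PiLp.norm_apply_le _ j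
      rw [PiLp.smul_apply, siteToE_apply, smul_eq_mul, norm_mul, Real.norm_of_nonneg ha.le,
        Real.norm_eq_abs] at h1
      exact h1.trans hv
    have hR0 : 0 ≤ R := (norm_nonneg _).trans hv
    -- both evaluation points are far out
    have hz1 : ℓ ≤ ‖(fun i => sch.a k • siteToE (y i) : Fin p → EuclideanSpace ℝ (Fin 4))‖ := by
      refine le_trans ?_ (mul_abs_le_norm ha.le y i j)
      have h1 : ((sch.L k : ℤ) : ℝ) + 1 ≤ |((y i j : ℤ) : ℝ)| := by rw [hyij]; exact_mod_cast hfar1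
      have h2 : sch.a k * ((sch.L k : ℝ) + 1) ≤ sch.a k * |((y i j : ℤ) : ℝ)| :=
        mul_le_mul_of_nonneg_left (by exact_mod_cast h1) ha.le
      rw [hℓ_def]
      nlinarith
    have hz2 : ℓ ≤ ‖(fun i => sch.a k • siteToE (ρ i) : Fin p → EuclideanSpace ℝ (Fin 4))‖ := by
      refine le_trans ?_ (mul_abs_le_norm ha.le ρ i j)
      have h1 : ((sch.L k : ℤ) : ℝ) + 1 - |((v j : ℤ) : ℝ)| ≤ |((ρ i j : ℤ) : ℝ)| := by
        rw [hρij]; exact_mod_cast hfar2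
      have h2 : sch.a k * ((sch.L k : ℝ) + 1 - |((v j : ℤ) : ℝ)|) ≤ sch.a k * |((ρ i j : ℤ) : ℝ)| :=
        mul_le_mul_of_nonneg_left (by exact_mod_cast h1) ha.le
      rw [hℓ_def]
      nlinarith
    have hF1 := norm_apply_le_seminorm_div F N hℓ hz1
    have hF2 := norm_apply_le_seminorm_div F N hℓ hz2
    calc ‖F (fun i => sch.a k • siteToE (y i)) - F (fun i => sch.a k • siteToE (ρ i))‖ *
          |∫ U, ∏ i, cw r sch k (y i) U ∂(μW r sch k)|
        ≤ (SchwartzMap.seminorm ℂ N 0 F / ℓ ^ N + SchwartzMap.seminorm ℂ N 0 F / ℓ ^ N) * C ^ p :=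
          mul_le_mul ((norm_sub_le _ _).trans (add_le_add hF1 hF2)) hH (abs_nonneg _) (by positivity)
      _ = 2 * C ^ p * SchwartzMap.seminorm ℂ N 0 F / ℓ ^ N := by ring

/-- The number of `p`-tuples of box sites is `(2L+1)^{4p}`. -/
theorem card_fun_box (L p : ℕ) : Fintype.card (Fin p → ↥(box 4 L)) = ((2 * L + 1) ^ 4) ^ p := by
  rw [Fintype.card_fun, Fintype.card_coe, card_box, Fintype.card_fin]

end Coefficient

end Transl

/-- **Registered anchor of this helper file — the quantitative seam bound.** For a `k`-uniform bound `C` of the centred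
curvature weights (it exists, `Transl.exists_uniform_bound_cw`), every Schwartz order `N`, every lattice vector `v` with
`‖a_k v‖ ≤ R < a_k L_k`:
`‖curvDistribution k p (F(· - a_k v)) - curvDistribution k p F‖ ≤ (2L_k+1)^{4p} · 2 C^p ‖F‖_{N,0} / (a_k L_k - R)^N`. -/
theorem translA_norm_translate_sub_le :
    ∀ {G : Type} [Group G] [TopologicalSpace G] [IsTopologicalGroup G] [CompactSpace G]
      [MeasurableSpace G] [BorelSpace G] (r : LatticeRep G) (sch : SpeciesScheme (YMSpecies G)) (C : ℝ),
      0 ≤ C → (∀ k x U, |cw r sch k x U| ≤ C) →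
      ∀ (k p N : ℕ) (F : 𝓢((Fin p → EuclideanSpace ℝ (Fin 4)), ℂ)) (v : Site 4) (R : ℝ),
      ‖sch.a k • siteToE v‖ ≤ R → R < sch.a k * sch.L k →
      ‖curvDistribution r sch k p (translateMulti (sch.a k • siteToE v) F) - curvDistribution r sch k p F‖ ≤
        (((2 * sch.L k + 1) ^ 4) ^ p : ℕ) * (2 * C ^ p * SchwartzMap.seminorm ℂ N 0 F / (sch.a k * sch.L k - R) ^ N) := by
  intro G _ _ _ _ _ _ r sch C hC0 hC k p N F v R hv hR
  rw [Transl.curvDistribution_translate_sub]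
  refine (norm_sum_le _ _).trans ?_
  refine (Finset.sum_le_sum fun x _ => Transl.norm_seamTerm_le r sch hC0 hC k p N F v hv hR x).trans ?_
  rw [Finset.sum_const, Finset.card_univ, Transl.card_fun_box, nsmul_eq_mul]

end Summit.QuantumFields.YangMills.Cruxes.ContinuumLimitOnTrajectory.TwoOrbitSynchronisation

end
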